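import Literature.AnabelianGeometry.SemiGraphs.FundamentalGroup

/-!
# The universal graph-covering of a semi-graph ([SemiAnbd] §1 p. 15, §3 p. 38)

Mochizuki, *Semi-graphs of anabelioids*, Publ. RIMS **42** (2006): p. 15 "universal
graph-coverings" (the topological fundamental group of a semi-graph acts on its universal
graph-covering), used on p. 38: "`𝒢_{∞,i} → 𝒢_i` for the covering of `𝒢_i` determined by the
*universal graph-covering* of the underlying semi-graph `𝔾_i` of `𝒢_i`" in the construction of the
tempered fundamental group `π₁^temp(𝒢) := lim_i Gal(𝒢_{∞,i}/𝒢)` (Proposition 3.6).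

Construction (standard, via the fundamental groupoid of `FundamentalGroup.lean`): fix a base
component `c₀` of `𝔾`.  The universal graph-covering `𝔾̃ → 𝔾` based at `c₀` has as vertices
(resp. edges) over `v` (resp. `e`) the homotopy classes of paths from `c₀` to `v` (resp. `e`), i.e.
the morphisms `c₀ ⟶ v` (resp. `c₀ ⟶ e`) of the fundamental groupoid `Π(𝔾)` (the free groupoid on
`Cat(𝔾)`); the branches of an edge `(e, p)` of `𝔾̃` are the branches of `e`, the branch `b` of
`(e, p)` abutting to `(v, p ≫ b)` when `b` abuts to `v` (`b : e → v` an arrow of `Cat(𝔾)`).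

Main definitions and results:
* `univCover G c₀`, `univCoverProj G c₀ : univCover G c₀ ⟶ G`;
* `isGraphCovering_univCoverProj`: it is a graph-covering (proper and excisive);
* `fiberVertexEquiv` / `fiberEdgeEquiv`: the fibres over `v` / `e` are the hom-sets `c₀ ⟶ v`,
  `c₀ ⟶ e` of the fundamental groupoid;
* `deck γ`: the deck transformation attached to `γ ∈ π₁(𝔾, c₀)` (precomposition with `γ⁻¹`), a
  morphism over `𝔾`; `deck_mul`, `deck_one`; the action on each fibre is free and transitive
  (`deck_vertex_eq_self_iff`, `exists_deck_vertex_eq`).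

Deliberately NOT here: connectedness / contractibility of `𝔾̃` (van Kampen for semi-graphs), and
the objects of `B^cov(𝒢)` attached to graph-coverings (companion file).
-/

namespace Literature.AnabelianGeometry.SemiGraphs

namespace SemiGraph

open CategoryTheory

universe u

variable (G : SemiGraph.{u}) (c₀ : G.CatCarrier)

/-- The arrow `b : e → v` of `Cat(𝔾)` attached to a branch `b` of `e` abutting to `v`, as a morphism
of the fundamental groupoid. [cite: MochizukiSemiAnbd2006, Def. 2.11 p.32] -/
def brArrow (b : G.Branch) (e : G.Edge) (v : G.Vertex) (he : G.edgeOf b = e)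
    (hv : G.abuts b = some v) : G.basept (Sum.inr e) ⟶ G.basept (Sum.inl v) :=
  (Quiver.FreeGroupoid.of G.CatCarrier).map
    (show CatArrow (Sum.inr e) (Sum.inl v) from ⟨b, he, hv⟩)

/-- **The universal graph-covering `𝔾̃` of `𝔾` based at the component `c₀`** (p. 15): vertices
over `v` = morphisms `c₀ ⟶ v` of the fundamental groupoid, edges over `e` = morphisms `c₀ ⟶ e`,
the branches of `(e, p)` = the branches of `e`, with `b ∈ e` abutting to `(v, p ≫ b)` if `b`
abuts to `v` (and to nothing if `b` abuts to nothing). [cite: MochizukiSemiAnbd2006, §1 p.15] -/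
def univCover : SemiGraph.{u} where
  Vertex := Σ v : G.Vertex, (G.basept c₀ ⟶ G.basept (Sum.inl v))
  Edge := Σ e : G.Edge, (G.basept c₀ ⟶ G.basept (Sum.inr e))
  Branch := Σ et : (Σ e : G.Edge, (G.basept c₀ ⟶ G.basept (Sum.inr e))),
    {b : G.Branch // G.edgeOf b = et.1}
  edgeOf := Sigma.fst
  abuts := fun bt => (G.abuts bt.2.1).pmap
    (fun v (hv : G.abuts bt.2.1 = some v) => ⟨v, bt.1.2 ≫ G.brArrow bt.2.1 bt.1.1 v bt.2.2 hv⟩)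
    (fun _ hv => hv)
  two_branches := by
    rintro ⟨e, p⟩
    obtain ⟨b₁, b₂, hne, h₁, h₂, hall⟩ := G.two_branches e
    refine ⟨⟨⟨e, p⟩, ⟨b₁, h₁⟩⟩, ⟨⟨e, p⟩, ⟨b₂, h₂⟩⟩, ?_, rfl, rfl, ?_⟩
    · intro h
      apply hne
      have := congrArg (fun bt : Σ et : (Σ e : G.Edge, (G.basept c₀ ⟶ G.basept (Sum.inr e))),
        {b : G.Branch // G.edgeOf b = et.1} => bt.2.1) h
      exact this
    · rintro ⟨et, ⟨b, hb⟩⟩ (rfl : et = ⟨e, p⟩)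
      rcases hall b hb with rfl | rfl
      · exact Or.inl rfl
      · exact Or.inr rfl

/-- The coincidence map of `𝔾̃`, unfolded. [cite: MochizukiSemiAnbd2006, §1 p.15] -/
theorem univCover_abuts (bt : (G.univCover c₀).Branch) :
    (G.univCover c₀).abuts bt = (G.abuts bt.2.1).pmap
      (fun v (hv : G.abuts bt.2.1 = some v) =>
        (⟨v, bt.1.2 ≫ G.brArrow bt.2.1 bt.1.1 v bt.2.2 hv⟩ : (G.univCover c₀).Vertex))
      (fun _ hv => hv) := rfl

/-- The abutment of a branch of `𝔾̃` over a branch `b` of `𝔾` abutting to `v`.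
[cite: MochizukiSemiAnbd2006, §1 p.15] -/
theorem univCover_abuts_of_abuts (e : G.Edge) (p : G.basept c₀ ⟶ G.basept (Sum.inr e))
    (b : G.Branch) (hb : G.edgeOf b = e) (v : G.Vertex) (hv : G.abuts b = some v) :
    (G.univCover c₀).abuts ⟨⟨e, p⟩, ⟨b, hb⟩⟩ = some ⟨v, p ≫ G.brArrow b e v hb hv⟩ := by
  rw [univCover_abuts]
  exact Option.pmap_some' hv

/-- A branch of `𝔾̃` over a branch of `𝔾` abutting to no vertex abuts to no vertex.
[cite: MochizukiSemiAnbd2006, §1 p.15] -/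
theorem univCover_abuts_of_none (e : G.Edge) (p : G.basept c₀ ⟶ G.basept (Sum.inr e))
    (b : G.Branch) (hb : G.edgeOf b = e) (hv : G.abuts b = none) :
    (G.univCover c₀).abuts ⟨⟨e, p⟩, ⟨b, hb⟩⟩ = none := by
  rw [univCover_abuts]
  exact Option.pmap_none' hv

/-- The projection `𝔾̃ → 𝔾` of the universal graph-covering. [cite: MochizukiSemiAnbd2006, §1 p.15] -/
def univCoverProj : G.univCover c₀ ⟶ G where
  vertexMap := Sigma.fst
  edgeMap := Sigma.fst
  branchMap := fun bt => bt.2.1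
  edgeOf_branchMap := fun bt => bt.2.2
  branchMap_injOn := by
    rintro ⟨et₁, ⟨b₁, hb₁⟩⟩ ⟨et₂, ⟨b₂, hb₂⟩⟩ (he : et₁ = et₂) (hb : b₁ = b₂)
    subst he
    subst hb
    rfl
  abuts_branchMap := by
    rintro ⟨⟨e, p⟩, ⟨b, hb⟩⟩ ⟨v, q⟩ h
    change G.abuts b = some v
    rcases hab : G.abuts b with _ | v'
    · rw [G.univCover_abuts_of_none c₀ e p b hb hab] at h
      exact absurd h (by simp)
    · rw [G.univCover_abuts_of_abuts c₀ e p b hb v' hab] at h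
      exact congrArg some (congrArg Sigma.fst (Option.some.inj h))

/-- The fibre of `𝔾̃ → 𝔾` over a vertex `v` is the hom-set `c₀ ⟶ v` of the fundamental groupoid
(homotopy classes of paths from the base component to `v`). [cite: MochizukiSemiAnbd2006, §1 p.15] -/
def fiberVertexEquiv (v : G.Vertex) :
    {vt : (G.univCover c₀).Vertex // (G.univCoverProj c₀).vertexMap vt = v} ≃
      (G.basept c₀ ⟶ G.basept (Sum.inl v)) where
  toFun := fun vt => vt.2 ▸ vt.1.2
  invFun := fun p => ⟨⟨v, p⟩, rfl⟩
  left_inv := by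
    rintro ⟨⟨v', p⟩, (rfl : v' = v)⟩
    rfl
  right_inv := fun _ => rfl

/-- The fibre of `𝔾̃ → 𝔾` over an edge `e` is the hom-set `c₀ ⟶ e` of the fundamental groupoid.
[cite: MochizukiSemiAnbd2006, §1 p.15] -/
def fiberEdgeEquiv (e : G.Edge) :
    {et : (G.univCover c₀).Edge // (G.univCoverProj c₀).edgeMap et = e} ≃
      (G.basept c₀ ⟶ G.basept (Sum.inr e)) where
  toFun := fun et => et.2 ▸ et.1.2
  invFun := fun p => ⟨⟨e, p⟩, rfl⟩
  left_inv := by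
    rintro ⟨⟨e', p⟩, (rfl : e' = e)⟩
    rfl
  right_inv := fun _ => rfl

/-- **`𝔾̃ → 𝔾` is a graph-covering** (proper and excisive): the branches of `(e, p)` abutting to a
vertex are those of `e`, and the branches abutting to `(v, p)` correspond bijectively to the
branches abutting to `v`. [cite: MochizukiSemiAnbd2006, §1 p.15] -/
theorem isGraphCovering_univCoverProj : IsGraphCovering (G.univCoverProj c₀) := by
  constructor
  · -- proper: verticial cardinalities are preserved
    intro et
    obtain ⟨e, p⟩ := et
    change G.vertCard e = Nat.card ((G.univCover c₀).verticialPortion ⟨e, p⟩)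
    unfold vertCard
    refine Nat.card_congr ?_
    refine
      { toFun := fun b => ⟨⟨⟨e, p⟩, ⟨b.1, b.2.1⟩⟩, rfl, ?_⟩
        invFun := fun bt => ⟨bt.1.2.1, ?_, ?_⟩
        left_inv := fun b => rfl
        right_inv := ?_ }
    · -- abuts to some vertex upstairs
      obtain ⟨v, hv⟩ := Option.isSome_iff_exists.mp b.2.2
      rw [G.univCover_abuts_of_abuts c₀ e p b.1 b.2.1 v hv]
      rfl
    · -- the branch lies on `e`
      have h1 : bt.1.1 = ⟨e, p⟩ := bt.2.1
      exact bt.1.2.2.trans (congrArg Sigma.fst h1)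
    · -- abuts downstairs
      obtain ⟨⟨⟨e', p'⟩, ⟨b, hb⟩⟩, h1, h2⟩ := bt
      change ((G.univCover c₀).abuts ⟨⟨e', p'⟩, ⟨b, hb⟩⟩).isSome = true at h2
      change (G.abuts b).isSome = true
      rcases hab : G.abuts b with _ | v'
      · rw [G.univCover_abuts_of_none c₀ e' p' b hb hab] at h2
        exact absurd h2 (by simp)
      · rfl
    · rintro ⟨⟨et', ⟨b, hb⟩⟩, h1, h2⟩
      change et' = ⟨e, p⟩ at h1
      subst h1
      rfl
  · -- excision: stars correspond bijectively
    rintro ⟨v, p⟩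
    constructor
    · rintro ⟨⟨⟨e₁, p₁⟩, ⟨b₁, hb₁⟩⟩, h₁⟩ ⟨⟨⟨e₂, p₂⟩, ⟨b₂, hb₂⟩⟩, h₂⟩ h
      have hb : b₁ = b₂ := congrArg Subtype.val h
      subst hb
      have he : e₁ = e₂ := hb₁.symm.trans hb₂
      subst he
      -- the paths agree: `p₁ ≫ b = p = p₂ ≫ b`
      change (G.univCover c₀).abuts _ = some _ at h₁ h₂
      rw [G.univCover_abuts_of_abuts c₀ e₁ p₁ b₁ hb₁ v
        ((G.univCoverProj c₀).abuts_branchMap _ _ h₁)] at h₁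
      rw [G.univCover_abuts_of_abuts c₀ e₁ p₂ b₁ hb₂ v
        ((G.univCoverProj c₀).abuts_branchMap _ _ h₂)] at h₂
      have e1 := (Sigma.mk.inj_iff.mp (Option.some.inj h₁)).2
      have e2 := (Sigma.mk.inj_iff.mp (Option.some.inj h₂)).2
      have hp : p₁ = p₂ := (cancel_mono _).mp ((eq_of_heq e1).trans (eq_of_heq e2).symm)
      subst hp
      rfl
    · rintro ⟨b, hb⟩
      refine ⟨⟨⟨⟨G.edgeOf b, p ≫ inv (G.brArrow b (G.edgeOf b) v rfl hb)⟩, ⟨b, rfl⟩⟩, ?_⟩, rfl⟩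
      rw [G.univCover_abuts_of_abuts c₀ _ _ b rfl v hb, Category.assoc, IsIso.inv_hom_id,
        Category.comp_id]

/-- **Deck transformations**: the element `γ ∈ π₁(𝔾, c₀)` acts on `𝔾̃` by precomposing paths with
`γ⁻¹`. [cite: MochizukiSemiAnbd2006, §1 p.15] -/
noncomputable def deck (γ : G.FundamentalGroup c₀) : G.univCover c₀ ⟶ G.univCover c₀ where
  vertexMap := fun vt => ⟨vt.1, inv γ ≫ vt.2⟩
  edgeMap := fun et => ⟨et.1, inv γ ≫ et.2⟩
  branchMap := fun bt => ⟨⟨bt.1.1, inv γ ≫ bt.1.2⟩, bt.2⟩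
  edgeOf_branchMap := fun _ => rfl
  branchMap_injOn := by
    rintro ⟨et₁, b₁⟩ ⟨et₂, b₂⟩ (he : et₁ = et₂) h
    subst he
    obtain ⟨-, hb⟩ := Sigma.mk.inj_iff.mp h
    exact Sigma.ext rfl hb
  abuts_branchMap := by
    rintro ⟨⟨e, p⟩, ⟨b, hb⟩⟩ ⟨v, q⟩ h
    have hv := (G.univCoverProj c₀).abuts_branchMap _ _ h
    change G.abuts b = some v at hv
    rw [G.univCover_abuts_of_abuts c₀ e p b hb v hv] at h
    have hq := eq_of_heq (Sigma.mk.inj_iff.mp (Option.some.inj h)).2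
    change (G.univCover c₀).abuts ⟨⟨e, inv γ ≫ p⟩, ⟨b, hb⟩⟩ = some ⟨v, inv γ ≫ q⟩
    rw [G.univCover_abuts_of_abuts c₀ e _ b hb v hv, ← hq, Category.assoc]

/-- Deck transformations lie over `𝔾`. [cite: MochizukiSemiAnbd2006, §1 p.15] -/
theorem deck_comp_proj (γ : G.FundamentalGroup c₀) :
    G.deck c₀ γ ≫ G.univCoverProj c₀ = G.univCoverProj c₀ := rfl

/-- The deck action is a group action: `deck (γ * δ) = deck δ ≫ deck γ`... stated on vertices:
`deck 1 = id`. [cite: MochizukiSemiAnbd2006, §1 p.15] -/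
theorem deck_one : G.deck c₀ 1 = 𝟙 _ := by
  have h1 : inv (𝟙 (G.basept c₀)) = 𝟙 _ := IsIso.inv_id
  refine SemiGraph.hom_ext _ _ (funext fun vt => ?_) (funext fun et => ?_) (funext fun bt => ?_)
  · obtain ⟨v, p⟩ := vt
    change (⟨v, inv (𝟙 _) ≫ p⟩ : (G.univCover c₀).Vertex) = ⟨v, p⟩
    rw [h1, Category.id_comp]
  · obtain ⟨e, p⟩ := et
    change (⟨e, inv (𝟙 _) ≫ p⟩ : (G.univCover c₀).Edge) = ⟨e, p⟩
    rw [h1, Category.id_comp]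
  · obtain ⟨⟨e, p⟩, b⟩ := bt
    change (⟨⟨e, inv (𝟙 _) ≫ p⟩, b⟩ : (G.univCover c₀).Branch) = ⟨⟨e, p⟩, b⟩
    rw [h1, Category.id_comp]

/-- The deck action is compatible with the group law of `π₁(𝔾, c₀)` (composition of loops; with
Mathlib's diagrammatic `≫` on morphisms of semi-graphs: `deck (γ * δ) = deck γ ≫ deck δ`).
[cite: MochizukiSemiAnbd2006, §1 p.15] -/
theorem deck_mul (γ δ : G.FundamentalGroup c₀) :
    G.deck c₀ (γ * δ) = G.deck c₀ γ ≫ G.deck c₀ δ := by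
  have hinv : inv (γ ≫ δ) = inv δ ≫ inv γ := IsIso.inv_comp
  refine SemiGraph.hom_ext _ _ (funext fun vt => ?_) (funext fun et => ?_) (funext fun bt => ?_)
  · obtain ⟨v, p⟩ := vt
    change (⟨v, inv (γ ≫ δ) ≫ p⟩ : (G.univCover c₀).Vertex) = ⟨v, inv δ ≫ inv γ ≫ p⟩
    rw [hinv, Category.assoc]
  · obtain ⟨e, p⟩ := et
    change (⟨e, inv (γ ≫ δ) ≫ p⟩ : (G.univCover c₀).Edge) = ⟨e, inv δ ≫ inv γ ≫ p⟩
    rw [hinv, Category.assoc]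
  · obtain ⟨⟨e, p⟩, b⟩ := bt
    change (⟨⟨e, inv (γ ≫ δ) ≫ p⟩, b⟩ : (G.univCover c₀).Branch) = ⟨⟨e, inv δ ≫ inv γ ≫ p⟩, b⟩
    rw [hinv, Category.assoc]

/-- The deck action on the fibre over a vertex is **free**: `γ · vt = vt` only for `γ = 1`.
[cite: MochizukiSemiAnbd2006, §1 p.15] -/
theorem deck_vertex_eq_self_iff (γ : G.FundamentalGroup c₀) (vt : (G.univCover c₀).Vertex) :
    (G.deck c₀ γ).vertexMap vt = vt ↔ γ = 1 := by
  obtain ⟨v, p⟩ := vt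
  change (⟨v, inv γ ≫ p⟩ : (G.univCover c₀).Vertex) = ⟨v, p⟩ ↔ γ = 1
  constructor
  · intro h
    have hp := eq_of_heq (Sigma.mk.inj_iff.mp h).2
    have : inv γ = 𝟙 _ := by
      rw [← cancel_mono p, Category.id_comp]
      exact hp
    exact IsIso.inv_eq_inv.mp (this.trans IsIso.inv_id.symm)
  · rintro rfl
    change (⟨v, inv (𝟙 _) ≫ p⟩ : (G.univCover c₀).Vertex) = ⟨v, p⟩
    rw [show inv (𝟙 (G.basept c₀)) = 𝟙 _ from IsIso.inv_id, Category.id_comp]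

/-- The deck action on the fibre over a vertex is **transitive**.
[cite: MochizukiSemiAnbd2006, §1 p.15] -/
theorem exists_deck_vertex_eq (v : G.Vertex) (p q : G.basept c₀ ⟶ G.basept (Sum.inl v)) :
    ∃ γ : G.FundamentalGroup c₀, (G.deck c₀ γ).vertexMap ⟨v, p⟩ = ⟨v, q⟩ := by
  refine ⟨p ≫ inv q, ?_⟩
  change (⟨v, inv (p ≫ inv q) ≫ p⟩ : (G.univCover c₀).Vertex) = ⟨v, q⟩
  rw [IsIso.inv_comp, IsIso.inv_inv, Category.assoc, IsIso.inv_hom_id, Category.comp_id]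

/-- The deck action on the fibre over an edge is free. [cite: MochizukiSemiAnbd2006, §1 p.15] -/
theorem deck_edge_eq_self_iff (γ : G.FundamentalGroup c₀) (et : (G.univCover c₀).Edge) :
    (G.deck c₀ γ).edgeMap et = et ↔ γ = 1 := by
  obtain ⟨e, p⟩ := et
  change (⟨e, inv γ ≫ p⟩ : (G.univCover c₀).Edge) = ⟨e, p⟩ ↔ γ = 1
  constructor
  · intro h
    have hp := eq_of_heq (Sigma.mk.inj_iff.mp h).2
    have : inv γ = 𝟙 _ := by
      rw [← cancel_mono p, Category.id_comp]
      exact hp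
    exact IsIso.inv_eq_inv.mp (this.trans IsIso.inv_id.symm)
  · rintro rfl
    change (⟨e, inv (𝟙 _) ≫ p⟩ : (G.univCover c₀).Edge) = ⟨e, p⟩
    rw [show inv (𝟙 (G.basept c₀)) = 𝟙 _ from IsIso.inv_id, Category.id_comp]

/-- The deck action on the fibre over an edge is transitive. [cite: MochizukiSemiAnbd2006, §1 p.15] -/
theorem exists_deck_edge_eq (e : G.Edge) (p q : G.basept c₀ ⟶ G.basept (Sum.inr e)) :
    ∃ γ : G.FundamentalGroup c₀, (G.deck c₀ γ).edgeMap ⟨e, p⟩ = ⟨e, q⟩ := by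
  refine ⟨p ≫ inv q, ?_⟩
  change (⟨e, inv (p ≫ inv q) ≫ p⟩ : (G.univCover c₀).Edge) = ⟨e, q⟩
  rw [IsIso.inv_comp, IsIso.inv_inv, Category.assoc, IsIso.inv_hom_id, Category.comp_id]

end SemiGraph

end Literature.AnabelianGeometry.SemiGraphs
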